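import Mathlib
import HarnessLib
import Summits.Ventures.LatticeQCDFlow.Exactness.U1WilsonFlowLOExactForceErgodic
import Summits.Ventures.LatticeQCDFlow.Exactness.U1WordFTHMC

/-!
# `U(1)` rung: multi-step OMF4 (the 11-stage fourth-order word) FT-HMC through the LO Wilson-flow member WITH THE ENGINE'S EXACT AUTODIFF KICKS converges to the Wilson measure from every start in an explicit window

HONEST FRAMING: exact (Metropolis-corrected) sampling algorithms for lattice gauge theory;
figures of merit are autocorrelation/cost numbers at stated couplings and volumes; no
continuum-physics claim.

Venture `LatticeQCDFlow` (cell pub-lqcd), topic `Exactness`; FANOUT row 14 (`eng-flowhmc`, engine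
`latflow.fthmc`, family B, integrator `omf4`, `U(1)` rung; member any schedule packaged VERBATIM as in
`exists_layers_u1WilsonFlowLO`; the three OMF4 kicks ARE the engine's autodiff forces
`g_j(V)(e) = κ_j · fderiv (p ↦ (β S_W∘F − log J)(e^(icp)·V)) 0 (δ_e)`, `j ∈ {v, l, c}`).  NEW WORK of
the cell over this row's `U1WilsonFlowLOExactForceLipschitz` / `U1WilsonFlowLOExactForceErgodic`
(explicit sup and Lipschitz constants `b̄(κ)`, `K̄(κ)`) and GEN-12's `U1WordFTHMC`
(`u1Omf4FTHMC_pow_uniformlyErgodic`, signed drift coefficients `r, q, c'` with `τ = 2r + 2q + c' > 0`);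
nothing is cited as a fact; no number.

* **`u1WilsonFlowLO_member_omf4_fthmc_exactForce_uniformlyErgodic`** — `L ≥ 2`, proper colouring,
  `2(d−1)|ε| < 1`, any schedule, `β, c, κ_v, κ_l, κ_c`, drift coefficients `|r|, |q|, |c'| ≤ c₀`,
  `τ = 2r + 2q + c' > 0`, `κ' > 0`, `n ≥ 1`, and, for any `K_b ≥ K̄(κ_v) + K̄(κ_l) + K̄(κ_c)`:
  `121 K_b c₀ ≤ 1/2`, `3(22 K_b τ² n² + 484 K_b c₀ τ n + 5324 K_b c₀²) ≤ τ`, `22 K_b τ n² + 484 K_b c₀ n ≤ 1`: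
  the `n`-step OMF4 FT-HMC chain with the exact kicks, reported through the member, converges to
  `wilsonMeasure u1Rep β` geometrically from EVERY initial law.

NOT CLAIMED: longer trajectories; sharp constants; `SU(2)`; floating point; any number.
-/

noncomputable section

namespace Summit.Ventures.LatticeQCDFlow.Exactness

open Set MeasureTheory
open ProbabilityTheory ProbabilityTheory.Kernel
open Literature.MathematicalPhysics.QuantumFieldTheory Literature.MathematicalPhysics.QuantumLattice
open scoped ENNReal NNReal

variable {d L : ℕ} {X : Type*} [DecidableEq X] (χ : Site d L → X) [NeZero L]

set_option maxHeartbeats 400000 in -- RN-23 (7)(b): heavy declaration budgeted at source (lake build ≈ 10 % hungrier than the gate)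
/-- **MULTI-STEP OMF4 FT-HMC THROUGH THE `U(1)` LO MEMBER WITH THE EXACT AUTODIFF KICKS CONVERGES TO
THE WILSON MEASURE FROM EVERY START** in the explicit window of the module docstring. -/
theorem u1WilsonFlowLO_member_omf4_fthmc_exactForce_uniformlyErgodic (hL : 2 ≤ L)
    (hχ : ∀ (x : Site d L) (i : Fin d), χ (x.shift i) ≠ χ x) {ε : ℝ}
    (hε : |ε| * (2 * ((d - 1 : ℕ) : ℝ)) < 1) (sched : List (Fin d × X)) (β c κᵥ κₗ κc : ℝ)
    {r q c' c₀ κ' : ℝ} (hc₀ : 0 ≤ c₀) (hr : |r| ≤ c₀) (hq : |q| ≤ c₀) (hc' : |c'| ≤ c₀)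
    (hτ0 : 0 < 2 * r + 2 * q + c') (hκ' : 0 < κ') {n : ℕ} (hn0 : 0 < n) {Kb : ℝ}
    (hKb : (1 + 8 * ((d - 1 : ℕ) : ℝ) * |ε|) ^ (2 * sched.length) *
        (8 * ((d - 1 : ℕ) : ℝ) * |β * c * κᵥ| + (sched.length : ℝ) *
          (4 * (8 * ((d - 1 : ℕ) : ℝ) * |ε|) *
            (2 * ((d - 1 : ℕ) : ℝ) * |β * c * κᵥ| + (sched.length : ℝ) *
              (|κᵥ| * |c| * |ε| * (8 * ((d - 1 : ℕ) : ℝ)) / (1 - |ε| * (2 * ((d - 1 : ℕ) : ℝ))))) +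
           |κᵥ| * |c| * |ε| * (32 * ((d - 1 : ℕ) : ℝ) / (1 - |ε| * (2 * ((d - 1 : ℕ) : ℝ))) +
             64 * ((d - 1 : ℕ) : ℝ) ^ 2 * |ε| / (1 - |ε| * (2 * ((d - 1 : ℕ) : ℝ))) ^ 2))) +
      (1 + 8 * ((d - 1 : ℕ) : ℝ) * |ε|) ^ (2 * sched.length) *
        (8 * ((d - 1 : ℕ) : ℝ) * |β * c * κₗ| + (sched.length : ℝ) *
          (4 * (8 * ((d - 1 : ℕ) : ℝ) * |ε|) *
            (2 * ((d - 1 : ℕ) : ℝ) * |β * c * κₗ| + (sched.length : ℝ) *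
              (|κₗ| * |c| * |ε| * (8 * ((d - 1 : ℕ) : ℝ)) / (1 - |ε| * (2 * ((d - 1 : ℕ) : ℝ))))) +
           |κₗ| * |c| * |ε| * (32 * ((d - 1 : ℕ) : ℝ) / (1 - |ε| * (2 * ((d - 1 : ℕ) : ℝ))) +
             64 * ((d - 1 : ℕ) : ℝ) ^ 2 * |ε| / (1 - |ε| * (2 * ((d - 1 : ℕ) : ℝ))) ^ 2))) +
      (1 + 8 * ((d - 1 : ℕ) : ℝ) * |ε|) ^ (2 * sched.length) *
        (8 * ((d - 1 : ℕ) : ℝ) * |β * c * κc| + (sched.length : ℝ) *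
          (4 * (8 * ((d - 1 : ℕ) : ℝ) * |ε|) *
            (2 * ((d - 1 : ℕ) : ℝ) * |β * c * κc| + (sched.length : ℝ) *
              (|κc| * |c| * |ε| * (8 * ((d - 1 : ℕ) : ℝ)) / (1 - |ε| * (2 * ((d - 1 : ℕ) : ℝ))))) +
           |κc| * |c| * |ε| * (32 * ((d - 1 : ℕ) : ℝ) / (1 - |ε| * (2 * ((d - 1 : ℕ) : ℝ))) +
             64 * ((d - 1 : ℕ) : ℝ) ^ 2 * |ε| / (1 - |ε| * (2 * ((d - 1 : ℕ) : ℝ))) ^ 2))) ≤ Kb)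
    (hm : 121 * Kb * c₀ ≤ 1 / 2)
    (h1 : 3 * (22 * Kb * (2 * r + 2 * q + c') ^ 2 * (n : ℝ) ^ 2 + 484 * Kb * c₀ * (2 * r + 2 * q + c') * n +
      5324 * Kb * c₀ ^ 2) ≤ 2 * r + 2 * q + c')
    (h2 : 22 * Kb * (2 * r + 2 * q + c') * (n : ℝ) ^ 2 + 484 * Kb * c₀ * n ≤ 1) :
    ∃ layers : List ((GaugeConfig d L Circle ≃ᵐ GaugeConfig d L Circle) × (GaugeConfig d L Circle → ℝ)),
      layers.map (fun Ly => ((Ly.1 : GaugeConfig d L Circle → GaugeConfig d L Circle), Ly.2)) = sched.map (fun s =>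
        ((fun (V : GaugeConfig d L Circle) (e : Edge d L) => if e.2 = s.1 ∧ χ e.1 = s.2 then
          V e * Circle.exp (ε * ∑ ν ∈ Finset.univ.erase e.2,
            (((plaquetteHolonomy V (e.1 - Pi.single ν 1) e.2 ν : Circle) : ℂ).im -
              ((plaquetteHolonomy V e.1 e.2 ν : Circle) : ℂ).im)) else V e),
         fun V : GaugeConfig d L Circle => ∏ a : {e : Edge d L // e.2 = s.1 ∧ χ e.1 = s.2},
          (1 - ε * ∑ ν ∈ Finset.univ.erase a.1.2,
            (((plaquetteHolonomy V a.1.1 a.1.2 ν : Circle) : ℂ).re +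
              ((plaquetteHolonomy V (a.1.1 - Pi.single ν 1) a.1.2 ν : Circle) : ℂ).re)))) ∧
      ∃ hgᵥ : Measurable (fun V : GaugeConfig d L Circle => (fun i : Edge d L => κᵥ * fderiv ℝ (fun p : (Edge d L → ℝ) =>
        (fun W : GaugeConfig d L Circle => β * wilsonAction u1Rep ((layers.foldr (fun Ly (F : GaugeConfig d L Circle ≃ᵐ GaugeConfig d L Circle) => Ly.1.trans F) (MeasurableEquiv.refl (GaugeConfig d L Circle))) W) - Real.log ((layers.foldr (fun Ly K => fun v => Ly.2 v * K (Ly.1 v)) (fun _ => (1 : ℝ))) W)) ((fun i : Edge d L => Circle.exp (c * p i)) * V)) 0 (Pi.single i 1))),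
      ∃ hgₗ : Measurable (fun V : GaugeConfig d L Circle => (fun i : Edge d L => κₗ * fderiv ℝ (fun p : (Edge d L → ℝ) =>
        (fun W : GaugeConfig d L Circle => β * wilsonAction u1Rep ((layers.foldr (fun Ly (F : GaugeConfig d L Circle ≃ᵐ GaugeConfig d L Circle) => Ly.1.trans F) (MeasurableEquiv.refl (GaugeConfig d L Circle))) W) - Real.log ((layers.foldr (fun Ly K => fun v => Ly.2 v * K (Ly.1 v)) (fun _ => (1 : ℝ))) W)) ((fun i : Edge d L => Circle.exp (c * p i)) * V)) 0 (Pi.single i 1))),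
      ∃ hgc : Measurable (fun V : GaugeConfig d L Circle => (fun i : Edge d L => κc * fderiv ℝ (fun p : (Edge d L → ℝ) =>
        (fun W : GaugeConfig d L Circle => β * wilsonAction u1Rep ((layers.foldr (fun Ly (F : GaugeConfig d L Circle ≃ᵐ GaugeConfig d L Circle) => Ly.1.trans F) (MeasurableEquiv.refl (GaugeConfig d L Circle))) W) - Real.log ((layers.foldr (fun Ly K => fun v => Ly.2 v * K (Ly.1 v)) (fun _ => (1 : ℝ))) W)) ((fun i : Edge d L => Circle.exp (c * p i)) * V)) 0 (Pi.single i 1))),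
      ∃ δ : ℝ, 0 < δ ∧ δ ≤ 1 ∧ ∀ (μ₀ : Measure (GaugeConfig d L Circle)) [IsProbabilityMeasure μ₀]
        (t : ℕ) (A : Set (GaugeConfig d L Circle)),
        |((fun m : Measure (GaugeConfig d L Circle) =>
              m.bind (conjKernel (refreshUpdate (involMH _
                  (measurable_u1Omf4Proposal_pow r q c' _ _ _ hgᵥ hgₗ hgc n)
                  fun z : GaugeConfig d L Circle × (Edge d L → ℝ) =>
                    (β * wilsonAction u1Rep ((layers.foldr (fun Ly (F : GaugeConfig d L Circle ≃ᵐ GaugeConfig d L Circle) => Ly.1.trans F) (MeasurableEquiv.refl (GaugeConfig d L Circle))) z.1) - Real.log ((layers.foldr (fun Ly K => fun v => Ly.2 v * K (Ly.1 v)) (fun _ => (1 : ℝ))) z.1)) + u1Kinetic κ' z.2)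
                  (u1MomentumLaw κ'))
                (layers.foldr (fun Ly (F : GaugeConfig d L Circle ≃ᵐ GaugeConfig d L Circle) => Ly.1.trans F) (MeasurableEquiv.refl (GaugeConfig d L Circle)))))^[t] μ₀).real A
            - (wilsonMeasure (d := d) (L := L) u1Rep β).real A| ≤ (1 - δ) ^ t := by
  obtain ⟨layers, hmap, hpos, hmeas, hjac⟩ := exists_layers_u1WilsonFlowLO χ hχ hε sched
  refine ⟨layers, hmap, ?_⟩
  have hS0c : Continuous fun U : GaugeConfig d L Circle => β * wilsonAction u1Rep U :=
    continuous_smul_wilsonAction u1Rep continuous_u1Rep β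
  have hSc := u1WilsonFlowLO_member_ftAction_continuous χ ε sched layers hmap hpos hS0c
  refine ⟨measurable_u1ExactForce hSc c κᵥ, measurable_u1ExactForce hSc c κₗ,
    measurable_u1ExactForce hSc c κc, ?_⟩
  obtain ⟨-, hBv, hKv⟩ := u1WilsonFlowLO_member_exactForce_bounds χ hL hε sched layers hmap hpos β c κᵥ
  obtain ⟨-, hBl, hKl⟩ := u1WilsonFlowLO_member_exactForce_bounds χ hL hε sched layers hmap hpos β c κₗ
  obtain ⟨-, hBc, hKc⟩ := u1WilsonFlowLO_member_exactForce_bounds χ hL hε sched layers hmap hpos β c κc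
  have hmε : 0 < 1 - |ε| * (2 * ((d - 1 : ℕ) : ℝ)) := by linarith
  have hbv0 : 0 ≤ (1 + 8 * ((d - 1 : ℕ) : ℝ) * |ε|) ^ sched.length *
        (2 * ((d - 1 : ℕ) : ℝ) * |β * c * κᵥ| + (sched.length : ℝ) *
          (|κᵥ| * |c| * |ε| * (8 * ((d - 1 : ℕ) : ℝ)) / (1 - |ε| * (2 * ((d - 1 : ℕ) : ℝ))))) := by
    positivity
  have hbl0 : 0 ≤ (1 + 8 * ((d - 1 : ℕ) : ℝ) * |ε|) ^ sched.length *
        (2 * ((d - 1 : ℕ) : ℝ) * |β * c * κₗ| + (sched.length : ℝ) *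
          (|κₗ| * |c| * |ε| * (8 * ((d - 1 : ℕ) : ℝ)) / (1 - |ε| * (2 * ((d - 1 : ℕ) : ℝ))))) := by
    positivity
  have hbc0 : 0 ≤ (1 + 8 * ((d - 1 : ℕ) : ℝ) * |ε|) ^ sched.length *
        (2 * ((d - 1 : ℕ) : ℝ) * |β * c * κc| + (sched.length : ℝ) *
          (|κc| * |c| * |ε| * (8 * ((d - 1 : ℕ) : ℝ)) / (1 - |ε| * (2 * ((d - 1 : ℕ) : ℝ))))) := by
    positivity
  have hKv0 : 0 ≤ (1 + 8 * ((d - 1 : ℕ) : ℝ) * |ε|) ^ (2 * sched.length) *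
        (8 * ((d - 1 : ℕ) : ℝ) * |β * c * κᵥ| + (sched.length : ℝ) *
          (4 * (8 * ((d - 1 : ℕ) : ℝ) * |ε|) *
            (2 * ((d - 1 : ℕ) : ℝ) * |β * c * κᵥ| + (sched.length : ℝ) *
              (|κᵥ| * |c| * |ε| * (8 * ((d - 1 : ℕ) : ℝ)) / (1 - |ε| * (2 * ((d - 1 : ℕ) : ℝ))))) +
           |κᵥ| * |c| * |ε| * (32 * ((d - 1 : ℕ) : ℝ) / (1 - |ε| * (2 * ((d - 1 : ℕ) : ℝ))) +
             64 * ((d - 1 : ℕ) : ℝ) ^ 2 * |ε| / (1 - |ε| * (2 * ((d - 1 : ℕ) : ℝ))) ^ 2))) := by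
    positivity
  have hKl0 : 0 ≤ (1 + 8 * ((d - 1 : ℕ) : ℝ) * |ε|) ^ (2 * sched.length) *
        (8 * ((d - 1 : ℕ) : ℝ) * |β * c * κₗ| + (sched.length : ℝ) *
          (4 * (8 * ((d - 1 : ℕ) : ℝ) * |ε|) *
            (2 * ((d - 1 : ℕ) : ℝ) * |β * c * κₗ| + (sched.length : ℝ) *
              (|κₗ| * |c| * |ε| * (8 * ((d - 1 : ℕ) : ℝ)) / (1 - |ε| * (2 * ((d - 1 : ℕ) : ℝ))))) +
           |κₗ| * |c| * |ε| * (32 * ((d - 1 : ℕ) : ℝ) / (1 - |ε| * (2 * ((d - 1 : ℕ) : ℝ))) +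
             64 * ((d - 1 : ℕ) : ℝ) ^ 2 * |ε| / (1 - |ε| * (2 * ((d - 1 : ℕ) : ℝ))) ^ 2))) := by
    positivity
  have hKc0 : 0 ≤ (1 + 8 * ((d - 1 : ℕ) : ℝ) * |ε|) ^ (2 * sched.length) *
        (8 * ((d - 1 : ℕ) : ℝ) * |β * c * κc| + (sched.length : ℝ) *
          (4 * (8 * ((d - 1 : ℕ) : ℝ) * |ε|) *
            (2 * ((d - 1 : ℕ) : ℝ) * |β * c * κc| + (sched.length : ℝ) *
              (|κc| * |c| * |ε| * (8 * ((d - 1 : ℕ) : ℝ)) / (1 - |ε| * (2 * ((d - 1 : ℕ) : ℝ))))) +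
           |κc| * |c| * |ε| * (32 * ((d - 1 : ℕ) : ℝ) / (1 - |ε| * (2 * ((d - 1 : ℕ) : ℝ))) +
             64 * ((d - 1 : ℕ) : ℝ) ^ 2 * |ε| / (1 - |ε| * (2 * ((d - 1 : ℕ) : ℝ))) ^ 2))) := by
    positivity
  have hb0 : 0 ≤ (1 + 8 * ((d - 1 : ℕ) : ℝ) * |ε|) ^ sched.length *
        (2 * ((d - 1 : ℕ) : ℝ) * |β * c * κᵥ| + (sched.length : ℝ) *
          (|κᵥ| * |c| * |ε| * (8 * ((d - 1 : ℕ) : ℝ)) / (1 - |ε| * (2 * ((d - 1 : ℕ) : ℝ))))) +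
      (1 + 8 * ((d - 1 : ℕ) : ℝ) * |ε|) ^ sched.length *
        (2 * ((d - 1 : ℕ) : ℝ) * |β * c * κₗ| + (sched.length : ℝ) *
          (|κₗ| * |c| * |ε| * (8 * ((d - 1 : ℕ) : ℝ)) / (1 - |ε| * (2 * ((d - 1 : ℕ) : ℝ))))) +
      (1 + 8 * ((d - 1 : ℕ) : ℝ) * |ε|) ^ sched.length *
        (2 * ((d - 1 : ℕ) : ℝ) * |β * c * κc| + (sched.length : ℝ) *
          (|κc| * |c| * |ε| * (8 * ((d - 1 : ℕ) : ℝ)) / (1 - |ε| * (2 * ((d - 1 : ℕ) : ℝ))))) := add_nonneg (add_nonneg hbv0 hbl0) hbc0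
  have hK0 : 0 ≤ (1 + 8 * ((d - 1 : ℕ) : ℝ) * |ε|) ^ (2 * sched.length) *
        (8 * ((d - 1 : ℕ) : ℝ) * |β * c * κᵥ| + (sched.length : ℝ) *
          (4 * (8 * ((d - 1 : ℕ) : ℝ) * |ε|) *
            (2 * ((d - 1 : ℕ) : ℝ) * |β * c * κᵥ| + (sched.length : ℝ) *
              (|κᵥ| * |c| * |ε| * (8 * ((d - 1 : ℕ) : ℝ)) / (1 - |ε| * (2 * ((d - 1 : ℕ) : ℝ))))) +
           |κᵥ| * |c| * |ε| * (32 * ((d - 1 : ℕ) : ℝ) / (1 - |ε| * (2 * ((d - 1 : ℕ) : ℝ))) +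
             64 * ((d - 1 : ℕ) : ℝ) ^ 2 * |ε| / (1 - |ε| * (2 * ((d - 1 : ℕ) : ℝ))) ^ 2))) +
      (1 + 8 * ((d - 1 : ℕ) : ℝ) * |ε|) ^ (2 * sched.length) *
        (8 * ((d - 1 : ℕ) : ℝ) * |β * c * κₗ| + (sched.length : ℝ) *
          (4 * (8 * ((d - 1 : ℕ) : ℝ) * |ε|) *
            (2 * ((d - 1 : ℕ) : ℝ) * |β * c * κₗ| + (sched.length : ℝ) *
              (|κₗ| * |c| * |ε| * (8 * ((d - 1 : ℕ) : ℝ)) / (1 - |ε| * (2 * ((d - 1 : ℕ) : ℝ))))) +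
           |κₗ| * |c| * |ε| * (32 * ((d - 1 : ℕ) : ℝ) / (1 - |ε| * (2 * ((d - 1 : ℕ) : ℝ))) +
             64 * ((d - 1 : ℕ) : ℝ) ^ 2 * |ε| / (1 - |ε| * (2 * ((d - 1 : ℕ) : ℝ))) ^ 2))) +
      (1 + 8 * ((d - 1 : ℕ) : ℝ) * |ε|) ^ (2 * sched.length) *
        (8 * ((d - 1 : ℕ) : ℝ) * |β * c * κc| + (sched.length : ℝ) *
          (4 * (8 * ((d - 1 : ℕ) : ℝ) * |ε|) *
            (2 * ((d - 1 : ℕ) : ℝ) * |β * c * κc| + (sched.length : ℝ) *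
              (|κc| * |c| * |ε| * (8 * ((d - 1 : ℕ) : ℝ)) / (1 - |ε| * (2 * ((d - 1 : ℕ) : ℝ))))) +
           |κc| * |c| * |ε| * (32 * ((d - 1 : ℕ) : ℝ) / (1 - |ε| * (2 * ((d - 1 : ℕ) : ℝ))) +
             64 * ((d - 1 : ℕ) : ℝ) ^ 2 * |ε| / (1 - |ε| * (2 * ((d - 1 : ℕ) : ℝ))) ^ 2))) := add_nonneg (add_nonneg hKv0 hKl0) hKc0
  -- sup bounds for the whole momentum vector, common to the three kicks
  have hbᵥ : ∀ v : GaugeConfig d L Circle, ‖(fun V : GaugeConfig d L Circle => (fun i : Edge d L => κᵥ * fderiv ℝ (fun p : (Edge d L → ℝ) =>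
        (fun W : GaugeConfig d L Circle => β * wilsonAction u1Rep ((layers.foldr (fun Ly (F : GaugeConfig d L Circle ≃ᵐ GaugeConfig d L Circle) => Ly.1.trans F) (MeasurableEquiv.refl (GaugeConfig d L Circle))) W) - Real.log ((layers.foldr (fun Ly K => fun v => Ly.2 v * K (Ly.1 v)) (fun _ => (1 : ℝ))) W)) ((fun i : Edge d L => Circle.exp (c * p i)) * V)) 0 (Pi.single i 1))) v‖ ≤
      (1 + 8 * ((d - 1 : ℕ) : ℝ) * |ε|) ^ sched.length *
        (2 * ((d - 1 : ℕ) : ℝ) * |β * c * κᵥ| + (sched.length : ℝ) *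
          (|κᵥ| * |c| * |ε| * (8 * ((d - 1 : ℕ) : ℝ)) / (1 - |ε| * (2 * ((d - 1 : ℕ) : ℝ))))) +
      (1 + 8 * ((d - 1 : ℕ) : ℝ) * |ε|) ^ sched.length *
        (2 * ((d - 1 : ℕ) : ℝ) * |β * c * κₗ| + (sched.length : ℝ) *
          (|κₗ| * |c| * |ε| * (8 * ((d - 1 : ℕ) : ℝ)) / (1 - |ε| * (2 * ((d - 1 : ℕ) : ℝ))))) +
      (1 + 8 * ((d - 1 : ℕ) : ℝ) * |ε|) ^ sched.length *
        (2 * ((d - 1 : ℕ) : ℝ) * |β * c * κc| + (sched.length : ℝ) *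
          (|κc| * |c| * |ε| * (8 * ((d - 1 : ℕ) : ℝ)) / (1 - |ε| * (2 * ((d - 1 : ℕ) : ℝ))))) := fun v =>
    (pi_norm_le_iff_of_nonneg hb0).2 fun e => by
      beta_reduce
      rw [Real.norm_eq_abs]
      linarith [hBv v e]
  have hbₗ : ∀ v : GaugeConfig d L Circle, ‖(fun V : GaugeConfig d L Circle => (fun i : Edge d L => κₗ * fderiv ℝ (fun p : (Edge d L → ℝ) =>
        (fun W : GaugeConfig d L Circle => β * wilsonAction u1Rep ((layers.foldr (fun Ly (F : GaugeConfig d L Circle ≃ᵐ GaugeConfig d L Circle) => Ly.1.trans F) (MeasurableEquiv.refl (GaugeConfig d L Circle))) W) - Real.log ((layers.foldr (fun Ly K => fun v => Ly.2 v * K (Ly.1 v)) (fun _ => (1 : ℝ))) W)) ((fun i : Edge d L => Circle.exp (c * p i)) * V)) 0 (Pi.single i 1))) v‖ ≤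
      (1 + 8 * ((d - 1 : ℕ) : ℝ) * |ε|) ^ sched.length *
        (2 * ((d - 1 : ℕ) : ℝ) * |β * c * κᵥ| + (sched.length : ℝ) *
          (|κᵥ| * |c| * |ε| * (8 * ((d - 1 : ℕ) : ℝ)) / (1 - |ε| * (2 * ((d - 1 : ℕ) : ℝ))))) +
      (1 + 8 * ((d - 1 : ℕ) : ℝ) * |ε|) ^ sched.length *
        (2 * ((d - 1 : ℕ) : ℝ) * |β * c * κₗ| + (sched.length : ℝ) *
          (|κₗ| * |c| * |ε| * (8 * ((d - 1 : ℕ) : ℝ)) / (1 - |ε| * (2 * ((d - 1 : ℕ) : ℝ))))) +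
      (1 + 8 * ((d - 1 : ℕ) : ℝ) * |ε|) ^ sched.length *
        (2 * ((d - 1 : ℕ) : ℝ) * |β * c * κc| + (sched.length : ℝ) *
          (|κc| * |c| * |ε| * (8 * ((d - 1 : ℕ) : ℝ)) / (1 - |ε| * (2 * ((d - 1 : ℕ) : ℝ))))) := fun v =>
    (pi_norm_le_iff_of_nonneg hb0).2 fun e => by
      beta_reduce
      rw [Real.norm_eq_abs]
      linarith [hBl v e]
  have hb_c : ∀ v : GaugeConfig d L Circle, ‖(fun V : GaugeConfig d L Circle => (fun i : Edge d L => κc * fderiv ℝ (fun p : (Edge d L → ℝ) =>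
        (fun W : GaugeConfig d L Circle => β * wilsonAction u1Rep ((layers.foldr (fun Ly (F : GaugeConfig d L Circle ≃ᵐ GaugeConfig d L Circle) => Ly.1.trans F) (MeasurableEquiv.refl (GaugeConfig d L Circle))) W) - Real.log ((layers.foldr (fun Ly K => fun v => Ly.2 v * K (Ly.1 v)) (fun _ => (1 : ℝ))) W)) ((fun i : Edge d L => Circle.exp (c * p i)) * V)) 0 (Pi.single i 1))) v‖ ≤
      (1 + 8 * ((d - 1 : ℕ) : ℝ) * |ε|) ^ sched.length *
        (2 * ((d - 1 : ℕ) : ℝ) * |β * c * κᵥ| + (sched.length : ℝ) *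
          (|κᵥ| * |c| * |ε| * (8 * ((d - 1 : ℕ) : ℝ)) / (1 - |ε| * (2 * ((d - 1 : ℕ) : ℝ))))) +
      (1 + 8 * ((d - 1 : ℕ) : ℝ) * |ε|) ^ sched.length *
        (2 * ((d - 1 : ℕ) : ℝ) * |β * c * κₗ| + (sched.length : ℝ) *
          (|κₗ| * |c| * |ε| * (8 * ((d - 1 : ℕ) : ℝ)) / (1 - |ε| * (2 * ((d - 1 : ℕ) : ℝ))))) +
      (1 + 8 * ((d - 1 : ℕ) : ℝ) * |ε|) ^ sched.length *
        (2 * ((d - 1 : ℕ) : ℝ) * |β * c * κc| + (sched.length : ℝ) *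
          (|κc| * |c| * |ε| * (8 * ((d - 1 : ℕ) : ℝ)) / (1 - |ε| * (2 * ((d - 1 : ℕ) : ℝ))))) := fun v =>
    (pi_norm_le_iff_of_nonneg hb0).2 fun e => by
      beta_reduce
      rw [Real.norm_eq_abs]
      linarith [hBc v e]
  -- Lipschitz constants, common to the three kicks
  have hKb0 : 0 ≤ Kb := hK0.trans hKb
  have hLᵥ : LipschitzWith (Real.toNNReal Kb)
      (fun V : GaugeConfig d L Circle => (fun i : Edge d L => κᵥ * fderiv ℝ (fun p : (Edge d L → ℝ) =>
        (fun W : GaugeConfig d L Circle => β * wilsonAction u1Rep ((layers.foldr (fun Ly (F : GaugeConfig d L Circle ≃ᵐ GaugeConfig d L Circle) => Ly.1.trans F) (MeasurableEquiv.refl (GaugeConfig d L Circle))) W) - Real.log ((layers.foldr (fun Ly K => fun v => Ly.2 v * K (Ly.1 v)) (fun _ => (1 : ℝ))) W)) ((fun i : Edge d L => Circle.exp (c * p i)) * V)) 0 (Pi.single i 1))) := by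
    refine LipschitzWith.of_dist_le_mul fun V V' => ?_
    rw [Real.coe_toNNReal _ hKb0]
    refine (dist_pi_le_iff (mul_nonneg hKb0 dist_nonneg)).2 fun e => ?_
    rw [Real.dist_eq]
    refine (hKv V V' e).trans (mul_le_mul_of_nonneg_right ?_ dist_nonneg)
    linarith
  have hLₗ : LipschitzWith (Real.toNNReal Kb)
      (fun V : GaugeConfig d L Circle => (fun i : Edge d L => κₗ * fderiv ℝ (fun p : (Edge d L → ℝ) =>
        (fun W : GaugeConfig d L Circle => β * wilsonAction u1Rep ((layers.foldr (fun Ly (F : GaugeConfig d L Circle ≃ᵐ GaugeConfig d L Circle) => Ly.1.trans F) (MeasurableEquiv.refl (GaugeConfig d L Circle))) W) - Real.log ((layers.foldr (fun Ly K => fun v => Ly.2 v * K (Ly.1 v)) (fun _ => (1 : ℝ))) W)) ((fun i : Edge d L => Circle.exp (c * p i)) * V)) 0 (Pi.single i 1))) := by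
    refine LipschitzWith.of_dist_le_mul fun V V' => ?_
    rw [Real.coe_toNNReal _ hKb0]
    refine (dist_pi_le_iff (mul_nonneg hKb0 dist_nonneg)).2 fun e => ?_
    rw [Real.dist_eq]
    refine (hKl V V' e).trans (mul_le_mul_of_nonneg_right ?_ dist_nonneg)
    linarith
  have hL_c : LipschitzWith (Real.toNNReal Kb)
      (fun V : GaugeConfig d L Circle => (fun i : Edge d L => κc * fderiv ℝ (fun p : (Edge d L → ℝ) =>
        (fun W : GaugeConfig d L Circle => β * wilsonAction u1Rep ((layers.foldr (fun Ly (F : GaugeConfig d L Circle ≃ᵐ GaugeConfig d L Circle) => Ly.1.trans F) (MeasurableEquiv.refl (GaugeConfig d L Circle))) W) - Real.log ((layers.foldr (fun Ly K => fun v => Ly.2 v * K (Ly.1 v)) (fun _ => (1 : ℝ))) W)) ((fun i : Edge d L => Circle.exp (c * p i)) * V)) 0 (Pi.single i 1))) := by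
    refine LipschitzWith.of_dist_le_mul fun V V' => ?_
    rw [Real.coe_toNNReal _ hKb0]
    refine (dist_pi_le_iff (mul_nonneg hKb0 dist_nonneg)).2 fun e => ?_
    rw [Real.dist_eq]
    refine (hKc V V' e).trans (mul_le_mul_of_nonneg_right ?_ dist_nonneg)
    linarith
  -- pinched Jacobian of the member
  obtain ⟨-, hfmeas, hfjac⟩ := hasJacobian_foldr_trans layers hpos hmeas hjac
  have hpinch := u1WilsonFlowLO_layers_pinched χ hε.le sched layers hmap
  have hfold := fun v => foldr_logDet_mem_Icc layers (pow_nonneg hmε.le _) hpinch v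
  obtain ⟨s, hs⟩ := exists_bound_smul_wilsonAction_circle (d := d) (L := L) u1Rep continuous_u1Rep β
  have hcoe : ((Real.toNNReal Kb : ℝ≥0) : ℝ) = Kb := Real.coe_toNNReal _ hKb0
  obtain ⟨δ, hδ0, hδ1, hbound⟩ := u1Omf4FTHMC_pow_uniformlyErgodic
    (S := fun U : GaugeConfig d L Circle => β * wilsonAction u1Rep U) hb0 hc₀ hbᵥ hbₗ hb_c hLᵥ hLₗ hL_c
    hr hq hc' hτ0 (by rw [hcoe]; exact hm) hn0 (by rw [hcoe]; exact h1) (by rw [hcoe]; exact h2)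
    (measurable_u1ExactForce hSc c κᵥ) (measurable_u1ExactForce hSc c κₗ) (measurable_u1ExactForce hSc c κc)
    hκ' hS0c.measurable hs (pow_pos (pow_pos hmε _) _) (fun v => (hfold v).1) (fun v => (hfold v).2) hfmeas hfjac
  refine ⟨δ, hδ0, hδ1, fun μ₀ _ t A => ?_⟩
  rw [← u1GibbsLaw_eq_wilsonMeasure (d := d) (L := L) u1Rep β]
  exact hbound μ₀ t A

end Summit.Ventures.LatticeQCDFlow.Exactness
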